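import Literature.MathematicalPhysics.QuantumFieldTheory.BalabanImbrieJaffe1984to88.BIJ88Eq5128ScalarSector
import Literature.MathematicalPhysics.QuantumFieldTheory.BalabanImbrieJaffe1984to88.BIJ88Measure5127

/-!
# `BalabanImbrieJaffe1984to88.BIJ88Eq5127ProductMeasure` — T. Bałaban, J. Imbrie, A. Jaffe, *Effective action and cluster properties of the
abelian Higgs model*, Commun. Math. Phys. **114** (1988) 257–315 [BalabanImbrieJaffe1988], Sect. 5.12 *Conditional Integration*, **(5.12.7)** p. 302
[PDF 46] and **(5.12.8)** p. 303 [PDF 47] — **THE PRODUCT STRUCTURE OF THE INTERIOR MEASURE `dμ^{(k)}_{Λ^{(k)}_{10}}(A^{(k)″}, φ^{(k)″})` AT MEASURE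
LEVEL: with the weight of (5.12.7) = (gauge factor) × (scalar factor), the conditioned interior law of the frame IS (gauge conditional) ⊗
(p02's translated Gaussian `BIJ88Measure5127.muφ`), `𝒩 = 𝒩_gauge · Z_{Λ₁₀}(u_{k+1}) e^{thirdForm}`, and (5.12.8) holds with this weight — the scalar
factor BY NAME, the gauge factor abstract (PROVED; the factorization hypothesis of the frame DISCHARGED for the full weight).**

statement-level skeleton of published theorems with citation tags; proofs where landed; nothing here is a claim about the Yang–Mills mass gap

THE PRINT (p. 302 [PDF 46], verbatim in `BIJ88Measure5127`; re-read this session).  *"We make the same translation (5.12.4) in both numerator and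
denominator of the normalized integral in Λ^{(k)}_{10} … leaving the following integral: ∫dμ^{(k)}_{Λ^{(k)}_{10}}(A^{(k)″}, φ^{(k)″}) χ′_{Λ^{(k)}_7}
Π_{σ₁∈σ̃₁} F^{m̄}_{k,loc}(X_{σ₁}) e^{−V^{(k)}(Λ^{(k)}_8, u_{k+1}, A^{(k)}, φ^{(k)})}.  Here dμ^{(k)}_{Λ^{(k)}_{10}} is an uncentered, normalized Gaussian measure,
dμ^{(k)}_{Λ^{(k)}_{10}}(A^{(k)″}, φ^{(k)″}) = (1/𝒩) dA^{(k)″}|_{Λ^{(k)c*c}_{10}} dφ^{(k)″}|_{Λ^{(k)}_{10}} δ_{Ax,Λ^{(k)′}_{10}}(A^{(k)″}) δ_{Λ^{(k)′c*c}_{10}}(QΛ^{(k)c*c}_{10}A^{(k)″})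
× exp[−½⟨Λ^{(k)c*c}_{10}A^{(k)″}, ∂*σ_{k,loc}∂Λ^{(k)c*c}_{10}A^{(k)″}⟩ − ½⟨Λ^{(k)}_{10}φ^{(k)}, (Δ_{k,loc}(u_{k+1}) + aL^{−2}P(u_{k+1}))Λ^{(k)}_{10}φ^{(k)}⟩ − ⟨Λ^{(k)c*c}_{10}A^{(k)″},
(…)Λ^{(k)c*}_{10}A^{(k)}⟩ − ⟨Λ^{(k)}_{10}φ^{(k)″}, (…)Δ_{k,loc}(u_{k+1})Λ^{(k)c}_{10}φ^{(k)}⟩]. (5.12.7)  This measure has covariances C^{(k)}_{Λ^{(k)c*c}_{10}},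
C^{(k)}_{Λ^{(k)}_{10}}(u_{k+1}), and nonzero means reflecting the terms linear in Λ^{(k)}_{10}φ^{(k)″} or Λ^{(k)c*c}_{10}A^{(k)″}."*  The exponent has NO
`A″–φ″` cross term: the weight is a PRODUCT of a gauge factor and a scalar factor, each coupled linearly to exterior data only.

WHAT THIS FILE DOES (seat p34 gen 11, file 2; companion of `BIJ88Eq5128ScalarSector`, which treats the scalar factor alone).
 §1 GENERIC (measure theory of the conditioning, `BIJ88Eq5128CondExpect.condMeasure`): **`condMeasure_prod`** — a product weight on a product
    space conditions factor by factor, `𝒩(g⊗f)⁻¹(g⊗f)(μ⊗ν) = cond(μ,g) ⊗ cond(ν,f)` (`prod_withDensity`, `lintegral_prod_mul`);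
    `condMeasure_map_equiv` / `condMeasure_comp_equiv` — transport along a (measure-preserving) measurable equivalence (change of interior coordinates).
 §2 **`condMeasure_tilt`** — THE NORMALIZED TILTED GAUSSIAN IS p02's `muφ`: `cond(dx, e^{−⟨j,x⟩−½⟨x,Ax⟩}) = BIJ88Measure5127.muφ A j`
    (`= (gaussProb A).map (· − A⁻¹j)`: *"uncentered, normalized Gaussian … nonzero means"*; `tilt_eq` + translation invariance of `dx`).
 §3 ON THE TORUS CARRIERS: `pW = Wg · sW` — THE WEIGHT OF (5.12.7) with an ABSTRACT GAUGE FACTOR `Wg_t(q, v′, ψ)` (any positive jointly measurable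
    weight of the interior gauge and previous-field variables and of exterior data, NOT of the interior scalar variables — `hWgX` — integrable over
    each gauge fibre — `hWgi`) and the scalar factor `sW` of `BIJ88Eq5128ScalarSector` (p10's `wIn·cpl` BY NAME); `normG` = `𝒩` of the gauge factor;
    **`hfac_product`** (the factorization hypothesis of `BIJ88Eq5128Frame.isDC_of_isDT` DISCHARGED for brackets `X₀·Wg·exp(−½⟨φ^{(k)},M_t(v)φ^{(k)}⟩)·B₀`),
    weight data `measurable_pW`/`pW_pos`/`integrable_pW_fibre` (`Integrable.mul_prod` across the regrouping `((A″,u^{(j)}″),φ″) ↔ (A″,(u^{(j)}″,φ″))`,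
    Mathlib's `measurePreserving_prodAssoc`), **`normW_pW`**: `𝒩 = 𝒩_gauge · calN` (`integral_prod_mul`), **`eq5128_product`**: (5.12.8) `IsDC` with
    exterior bracket `X₀·exp(−½⟨Λ₁₀ᶜφ,MΛ₁₀ᶜφ⟩)·𝒩_gauge·Z_{Λ₁₀}(M_t(v))·e^{thirdForm}`, interior law `condW (Wg·wIn·cpl)`, interior bracket `B₀`.
 §4 **`condMeasure_pW_eq_prod`** / **`condW_pW_eq`** — (5.12.7) AT MEASURE LEVEL: over the fibre of an exterior configuration the conditioned
    interior law is (the regrouping image of) `cond(gauge fibre law, Wg) ⊗ (muφ (M_Λ) (ΛMΛᶜφ)).map chartIn⁻¹` — THE SCALAR FACTOR IS p02's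
    `muφ` BY NAME (covariance `C_{Λ₁₀}(u_{k+1}) = M_Λ⁻¹`, mean `−M_Λ⁻¹ΛMΛᶜφ`, p02's `meanφ`), in the real coordinates of `φ″|_{Λ₁₀}`.
    **`map_scalar_condMeasure_pW`** — the scalar MARGINAL of the conditioned interior law (pushed to the real coordinates of `φ″|_{Λ₁₀}`) IS `muφ`,
    and **`map_scalar_condMeasure_pW_eq_multivariateGaussian`** — read on `EuclideanSpace`, it IS Mathlib's
    `ProbabilityTheory.multivariateGaussian (meanφ) (M_Λ⁻¹)` (p02's `map_toLp_muφ`): *"This measure has covariances … C_{Λ₁₀}(u_{k+1}), and nonzero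
    means reflecting the terms linear in Λ₁₀φ″"* — the scalar half, literally.
 §5 instances `eq5128_product_axial` (`𝒟u δ_{Ax}`), `eq5128_product_qU` (locality by name for r18's `qU`).
HONEST SCOPE.  The gauge factor is ABSTRACT: its printed closed form ((5.12.3): `Z_{Λ^{c*c}_{10}}`, fourth/fifth forms; the gauge half of *"covariances
C_{Λ^{c*c}_{10}} … means … linear in Λ^{c*c}_{10}A″"*, p02's `muA`) needs the chart `u = e^{iηe_kA}` with the extension of `dA″` to `ℝ` and the
ℝ-Gaussian normalizer — the reading recorded as HOME/GAPS.md G-C2-23 (the frame's `𝒩` is the Haar-fibre total weight); not instantiated.  The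
localized translation (5.12.6) and the random-walk expansions of p. 302 are not performed.  No bound anywhere.  0 `sorry`, no `Prop`-valued fact,
standard axioms.

CITATION HEADER (lean-in-tree rule).  Part of the lit-balaban TYPED SKELETON (HOME `run/shared/lean/pub/lit-balaban/`), PHASE-2 proof seat p34
gen 11 (unit `lit-balaban-p34-g11`; TAKING line HOME/STATUS.md 2026-08-22T03:46:19Z; own lineage).  Rows served: **`C2.Eq5.12.8`** and support
**`C2.Eq5.12.1-5.12.7`** (member *"the measure (5.12.7) proper"*, p02's `BIJ88Measure5127`, here LIFTED to the torus carriers for its scalar factor) of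
`HOME/lit-balaban-r16/ROWS-C2-part2.md` (owner r16).  Built BY NAME on this seat's `BIJ88Eq5128ScalarSector` (p317381), p02's `BIJ88Measure5127` (`muφ`),
p10's `BIJ88Conditioning512` (`wIn`, `cpl`, `calN`, `wIn_mul_cpl`), r02/r14's `B2Eq228Conditioning` (`gaussProb`, `tilt_eq`), the tree's
`GaussianToolkit.map_withDensity_equiv`; nothing restated.  PDF held: `paper:balaban1988-cmp114-bij-abelian-higgs-effective-action` (journal page =
PDF page + 256).  Imports Literature + Mathlib only.
-/

namespace Literature.MathematicalPhysics.QuantumFieldTheory.BalabanImbrieJaffe1984to88.BIJ88Eq5127ProductMeasure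

open Literature.MathematicalPhysics.QuantumFieldTheory.Balaban1983to89
open BIJ88Sect3Statements (U1)
open BIJ85Sect1Model (HiggsField)
open BIJ88InductiveForm41 (Prev)
open BIJ88Eq596Display (uCut vCut vCut_apply IsDT)
open BIJ88Eq5128CondExpect (condNorm condMeasure condNorm_pos integral_condMeasure integral_condMeasure_mul lintegral_weight_eq
  condMeasure_const_mul)
open BIJ88Eq5128Split (Cfg UCfg PCfg cfgMeasure prevPi Interior)
open BIJ88Eq5128Display (IsDC termMeasure termIntegrand readEntry axialLaw)
open BIJ88Eq5128Display.Weight (normW condW normW_glue integral_condW_glue)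
open BIJ88Eq5128Frame (isDC_of_isDT isDT_axial_iff)
open BIJ88Eq5128ScalarSector (RIdx realCoords inIx xOf yOf chartIn chartOut Mq Mq_congr sW sX realCoords_eq_glue exp_quadForm_glue sX_freeze
  yOf_freeze xOf_glue yOf_glue measurable_sW sW_pos sW_glue integrable_wIn_cpl measurePreserving_chartIn integral_chartIn normW_sW
  calN_eq_Zscalar_mul_exp_thirdForm)
open B2Eq228Conditioning (In Out resIn resOut glue blkIn blkMix blkMix' blkOut gaussProb tilt_eq integrable_gaussWeight gaussWeight_pos)
open B13GaugeDevices (gaussWeight gaussNorm)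
open BIJ88Conditioning512 (wIn cpl calN srcJ wIn_mul_cpl)
open BIJ88ExteriorForms5121 (Zscalar thirdForm)
open BIJ88Measure5127 (muφ)
open scoped BigOperators ENNReal Matrix
open _root_.MeasureTheory _root_.MeasureTheory.Measure Function Set

noncomputable section

attribute [local instance 1001] Subtype.fintype

/-! ## §1 Conditioning a product weight on a product space; transport along measurable equivalences -/

section Generic

variable {α β : Type*} [MeasurableSpace α] [MeasurableSpace β]

/-- **A product weight conditions factor by factor**: `𝒩(g⊗f)⁻¹ (g⊗f)·(μ⊗ν) = (𝒩(g)⁻¹ g·μ) ⊗ (𝒩(f)⁻¹ f·ν)` for non-negative integrable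
weights of positive total mass (the measure-level form of *"This measure has covariances C_{Λ^{c*c}_{10}}, C_{Λ_{10}}(u_{k+1})"*: the gauge and the
scalar factors of (5.12.7) are independent). [cite: BalabanImbrieJaffe1988, (5.12.7) p.302] -/
theorem condMeasure_prod (μ : Measure α) (ν : Measure β) [SFinite μ] [SFinite ν] {g : α → ℝ} {f : β → ℝ} (hg : Measurable g)
    (hf : Measurable f) (hg0 : ∀ a, 0 ≤ g a) (hf0 : ∀ b, 0 ≤ f b) (hgi : Integrable g μ) (hfi : Integrable f ν) :
    condMeasure (μ.prod ν) (fun z => g z.1 * f z.2) = (condMeasure μ g).prod (condMeasure ν f) := by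
  unfold condMeasure
  rw [Measure.prod_smul_left, Measure.prod_smul_right, prod_withDensity hg.ennreal_ofReal hf.ennreal_ofReal, smul_smul]
  have h1 : (fun z : α × β => ENNReal.ofReal (g z.1 * f z.2)) = fun z => ENNReal.ofReal (g z.1) * ENNReal.ofReal (f z.2) := by
    funext z; exact ENNReal.ofReal_mul (hg0 _)
  rw [h1, lintegral_prod_mul hg.ennreal_ofReal.aemeasurable hf.ennreal_ofReal.aemeasurable]
  congr 1
  refine ENNReal.mul_inv (Or.inr ?_) (Or.inl ?_)
  · rw [lintegral_weight_eq hf0 hfi]; exact ENNReal.ofReal_ne_top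
  · rw [lintegral_weight_eq hg0 hgi]; exact ENNReal.ofReal_ne_top

/-- **Transport of the conditioned measure along a measurable equivalence** (a change of coordinates of the interior variables):
`cond(e_*μ, w) = e_* cond(μ, w ∘ e)`. [cite: BalabanImbrieJaffe1988, (5.12.7) p.302] -/
theorem condMeasure_map_equiv (e : α ≃ᵐ β) (μ : Measure α) (w : β → ℝ) :
    condMeasure (μ.map e) w = (condMeasure μ (w ∘ e)).map e := by
  unfold condMeasure
  rw [Measure.map_smul, lintegral_map_equiv, GaussianToolkit.map_withDensity_equiv]
  have h : ((fun i => ENNReal.ofReal ((w ∘ e) i)) ∘ e.symm) = fun i => ENNReal.ofReal (w i) := by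
    funext i; simp only [Function.comp_apply, MeasurableEquiv.apply_symm_apply]
  rw [h]
  rfl

/-- The same for a measure-preserving equivalence `e : (X, μ) → (Y, ν)`: `cond(μ, w ∘ e) = e⁻¹_* cond(ν, w)`. [cite: BalabanImbrieJaffe1988, (5.12.7) p.302] -/
theorem condMeasure_comp_equiv (e : α ≃ᵐ β) {μ : Measure α} {ν : Measure β} (he : MeasurePreserving e μ ν) (w : β → ℝ) :
    condMeasure μ (w ∘ e) = (condMeasure ν w).map e.symm := by
  have h := condMeasure_map_equiv e μ w
  rw [he.map_eq] at h
  rw [h, Measure.map_map e.symm.measurable e.measurable, MeasurableEquiv.symm_comp_self, Measure.map_id]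

end Generic

/-! ## §2 The tilted Gaussian weight conditions to p02's translated Gaussian `muφ` -/

section Tilt

variable {ι : Type} [Fintype ι] [DecidableEq ι]

omit [DecidableEq ι] in
/-- kernel: pushing a density of Lebesgue measure forward under a translation `x ↦ x − m` translates the density.
[folklore] [cite: BalabanImbrieJaffe1988, (5.12.7) p.302] -/
theorem withDensity_map_sub (F : (ι → ℝ) → ℝ≥0∞) (m : ι → ℝ) :
    ((volume : Measure (ι → ℝ)).withDensity F).map (fun x => x - m) = (volume : Measure (ι → ℝ)).withDensity fun x => F (x + m) := by
  have h := GaussianToolkit.map_withDensity_equiv (MeasurableEquiv.subRight m) (volume : Measure (ι → ℝ)) F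
  have hmap : Measure.map (⇑(MeasurableEquiv.subRight m)) (volume : Measure (ι → ℝ)) = volume :=
    (measurePreserving_sub_right (volume : Measure (ι → ℝ)) m).map_eq
  rw [hmap] at h
  exact h

/-- **THE NORMALIZED TILTED GAUSSIAN IS p02's `muφ`** — `𝒩⁻¹ e^{−⟨j,x⟩−½⟨x,Ax⟩} dx = (gaussProb A)` translated by `−A⁻¹j` (`BIJ88Measure5127.muφ A j`):
*"an uncentered, normalized Gaussian measure … covariance[] … C^{(k)}_{Λ^{(k)}_{10}}(u_{k+1}), and nonzero means reflecting the terms linear in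
Λ^{(k)}_{10}φ^{(k)″}"*, at measure level (`tilt_eq`: completing the square; translation invariance of `dx`). [cite: BalabanImbrieJaffe1988, (5.12.7) p.302] -/
theorem condMeasure_tilt {A : Matrix ι ι ℝ} (hA : A.PosDef) (j : ι → ℝ) :
    condMeasure (volume : Measure (ι → ℝ)) (fun x => Real.exp (-(j ⬝ᵥ x) - 1 / 2 * (x ⬝ᵥ (A *ᵥ x)))) = muφ A j := by
  have hAs : A.IsSymm := by
    have h := hA.isHermitian.eq
    rwa [Matrix.conjTranspose_eq_transpose_of_trivial] at h
  have hdet : IsUnit A.det := isUnit_iff_ne_zero.2 hA.det_pos.ne'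
  set m : ι → ℝ := A⁻¹ *ᵥ j with hm
  have h1 : (fun x : ι → ℝ => Real.exp (-(j ⬝ᵥ x) - 1 / 2 * (x ⬝ᵥ (A *ᵥ x)))) =
      fun x => Real.exp (1 / 2 * (j ⬝ᵥ (A⁻¹ *ᵥ j))) * gaussWeight A (x + m) := funext (tilt_eq A hAs hdet j)
  have hgm : Measurable fun x : ι → ℝ => gaussWeight A (x + m) :=
    (B2Eq228Conditioning.measurable_gaussWeight_real A).comp (measurable_add_const m)
  rw [h1, condMeasure_const_mul (Real.exp_pos _) hgm]
  unfold condMeasure BIJ88Measure5127.muφ B2Eq228Conditioning.gaussProb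
  rw [lintegral_add_right_eq_self (μ := (volume : Measure (ι → ℝ))) (fun x => ENNReal.ofReal (gaussWeight A x)) m,
    ← ofReal_integral_eq_lintegral_ofReal (integrable_gaussWeight hA) (Filter.Eventually.of_forall fun x => (gaussWeight_pos A x).le),
    Measure.map_smul, withDensity_map_sub, ENNReal.ofReal_inv_of_pos (B2Eq228Conditioning.gaussNorm_pos hA)]
  rfl

end Tilt

/-! ## §3 The weight of (5.12.7) on the torus carriers: gauge factor (abstract) × scalar factor (by name) -/

section Product

variable {P : Params} {k : ℕ}
variable {ι : Type*} (Λ : ι → Finset (PBond P (k+1))) (Qu : GaugeField P k U1 → GaugeField P (k+1) U1)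
variable (D : ι → Interior P k) (M : ι → GaugeField P (k+1) U1 → Matrix (RIdx P k) (RIdx P k) ℝ)
variable (Wg : ι → Cfg P k → GaugeField P (k+1) U1 → HiggsField P (k+1) → ℝ)

/-- **THE WEIGHT OF (5.12.7)** on the configuration space: a GAUGE FACTOR `Wg_t` (print: `exp[−½⟨Λ^{c*c}_{10}A″, ∂*σ_{k,loc}∂(Λ^{c*c}_{10} +
2Λ^{c*}_{10})A⟩]` in the chart `u = e^{iηe_kA}`; here ANY positive weight of the interior gauge and previous-field variables and of exterior data)
times the SCALAR FACTOR `sW_t` of `BIJ88Eq5128ScalarSector` (p10's `wIn·cpl` by name). [cite: BalabanImbrieJaffe1988, (5.12.7) p.302] -/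
def pW (t : ι) (q : Cfg P k) (v' : GaugeField P (k+1) U1) (ψ : HiggsField P (k+1)) : ℝ :=
  Wg t q v' ψ * sW Λ Qu D M t q v'

/-- an interior configuration with prescribed gauge and previous-field variables and the scalar variables frozen (`φ″ = 0`).
[cite: BalabanImbrieJaffe1988, (5.12.7) p.302] -/
def gaugePart (D₀ : Interior P k) (ab : D₀.IU × D₀.IP) : D₀.Int := (ab.1, (ab.2, D₀.base.2.2))

/-- kernel: `gaugePart` is measurable. [cite: BalabanImbrieJaffe1988, (5.12.7) p.302] -/
theorem measurable_gaugePart (D₀ : Interior P k) : Measurable (gaugePart D₀) :=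
  measurable_fst.prodMk (measurable_snd.prodMk measurable_const)

variable (m : PBond P k → Measure U1)

/-- **`𝒩` OF THE GAUGE FACTOR** over the fibre of the exterior configuration `e`: `∫ Wg d(du|_{Λ^{c*c}_{10}} Π_{j<k}du^{(j)}|_{Λ^{(j)*}_{10}})` (for the
printed Gaussian in the chart this is `Z_{Λ^{c*c}_{10}}·e^{fourthForm + fifthForm}` of (5.12.3), p02's `eq5123_calc`; kept abstract here).
[cite: BalabanImbrieJaffe1988, (5.12.3) p.301] -/
def normG (t : ι) (e : (D t).Ext) (v' : GaugeField P (k+1) U1) (ψ : HiggsField P (k+1)) : ℝ :=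
  ∫ ab, Wg t ((D t).glue e (gaugePart (D t) ab)) v' ψ ∂((D t).μIU m).prod (D t).μIP

variable {Λ Qu D M Wg m}

/-- **THE FACTORIZATION `hfac` FOR THE FULL WEIGHT OF (5.12.7).**  If the bracket read on configurations is `X₀ · Wg · exp(−½⟨φ^{(k)}, M_t(v)φ^{(k)}⟩) · B₀`
(`X₀` interior-independent, `M_t` symmetric), it factors as (exterior factor at the frozen configuration) × (`Wg · sW`) × `B₀`.
[cite: BalabanImbrieJaffe1988, (5.12.7) p.302] -/
theorem hfac_product {terms : Finset ι} (hMs : ∀ t v, (M t v).IsSymm)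
    {J : ι → Prev P k → GaugeField P k U1 → GaugeField P (k+1) U1 → HiggsField P k → HiggsField P (k+1) → ℂ}
    {X₀ B₀ : ι → Cfg P k → GaugeField P (k+1) U1 → HiggsField P (k+1) → ℂ}
    (hv : ∀ t ∈ terms, ∀ (q : Cfg P k) (v' : GaugeField P (k+1) U1), vCut Qu (Λ t) ((D t).freeze q).1 v' = vCut Qu (Λ t) q.1 v')
    (hX₀ : ∀ t ∈ terms, ∀ q v' ψ, X₀ t ((D t).freeze q) v' ψ = X₀ t q v' ψ)
    (hJ : ∀ t ∈ terms, ∀ q v' ψ, readEntry Λ Qu J t q v' ψ =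
      X₀ t q v' ψ * (Wg t q v' ψ : ℂ) *
        (Real.exp (-(1 / 2 : ℝ) * (realCoords q.2.2 ⬝ᵥ (M t (vCut Qu (Λ t) q.1 v') *ᵥ realCoords q.2.2))) : ℂ) * B₀ t q v' ψ) :
    ∀ t ∈ terms, ∀ (q : Cfg P k) (v' : GaugeField P (k+1) U1) (ψ : HiggsField P (k+1)),
      J t q.2.1 (uCut Qu (Λ t) q.1) (vCut Qu (Λ t) q.1 v') q.2.2 ψ =
        (X₀ t ((D t).freeze q) v' ψ * (sX Λ Qu D M t ((D t).freeze q) v' : ℂ)) * (pW Λ Qu D M Wg t q v' ψ : ℂ) * B₀ t q v' ψ := by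
  intro t ht q v' ψ
  have e1 := hJ t ht q v' ψ
  rw [readEntry] at e1
  rw [e1, hX₀ t ht, sX_freeze (hv t ht q v'), realCoords_eq_glue (D t) q, exp_quadForm_glue _ _ (hMs t _)]
  simp only [pW, sW, sX, Mq]
  push_cast
  ring

/-- **The weight of (5.12.7) is jointly measurable** (datum `hWm`), given a measurable gauge factor. [cite: BalabanImbrieJaffe1988, (5.12.7) p.302] -/
theorem measurable_pW (hQu : Measurable Qu) (hMm : ∀ t i j, Measurable fun v => M t v i j)
    (hWgm : ∀ t, Measurable fun p : Cfg P k × (GaugeField P (k+1) U1 × HiggsField P (k+1)) => Wg t p.1 p.2.1 p.2.2) (t : ι) :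
    Measurable fun p : Cfg P k × (GaugeField P (k+1) U1 × HiggsField P (k+1)) => pW Λ Qu D M Wg t p.1 p.2.1 p.2.2 :=
  (hWgm t).mul (measurable_sW hQu hMm t measurable_fst measurable_snd.fst)

/-- **The weight of (5.12.7) is strictly positive** (datum `hW0`). [cite: BalabanImbrieJaffe1988, (5.12.7) p.302] -/
theorem pW_pos (hWg0 : ∀ t q v' ψ, 0 < Wg t q v' ψ) (t : ι) (q : Cfg P k) (v' : GaugeField P (k+1) U1) (ψ : HiggsField P (k+1)) :
    0 < pW Λ Qu D M Wg t q v' ψ :=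
  mul_pos (hWg0 t q v' ψ) (sW_pos t q v')

variable [∀ b, IsProbabilityMeasure (m b)]

/-- **On an interior fibre the weight is (gauge factor of the gauge variables) × (scalar factor of the scalar variables)** — the product structure of
(5.12.7), read through the regrouping `(A″, (u^{(j)}″, φ″)) ↔ ((A″, u^{(j)}″), φ″)`. [cite: BalabanImbrieJaffe1988, (5.12.7) p.302] -/
theorem pW_glue_prodAssoc (t : ι) (v' : GaugeField P (k+1) U1) (ψ : HiggsField P (k+1))
    (hvq : ∀ q : Cfg P k, vCut Qu (Λ t) ((D t).freeze q).1 v' = vCut Qu (Λ t) q.1 v')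
    (hWgX : ∀ (e : (D t).Ext) (i : (D t).Int), Wg t ((D t).glue e i) v' ψ = Wg t ((D t).glue e (gaugePart (D t) (i.1, i.2.1))) v' ψ)
    (e : (D t).Ext) :
    (fun i => pW Λ Qu D M Wg t ((D t).glue e i) v' ψ) ∘ (MeasurableEquiv.prodAssoc : ((D t).IU × (D t).IP) × (D t).IX ≃ᵐ (D t).Int) =
      fun z => Wg t ((D t).glue e (gaugePart (D t) z.1)) v' ψ *
        (fun x => wIn (inIx (D t)) (Mq Λ Qu M t ((D t).glue e (D t).base) v') x *
          cpl (inIx (D t)) (Mq Λ Qu M t ((D t).glue e (D t).base) v') x (chartOut (D t) e.2.2)) (chartIn (D t) z.2) := by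
  funext z
  simp only [Function.comp_apply, pW]
  rw [hWgX, sW_glue t v' hvq]
  rfl

omit [∀ b, IsProbabilityMeasure (m b)] in
/-- **The weight of (5.12.7) is integrable over each interior fibre** (datum `hWi`), given a gauge factor integrable over the gauge fibre
(`Integrable.mul_prod` across the product structure). [cite: BalabanImbrieJaffe1988, (5.12.7) p.302] -/
theorem integrable_pW_fibre (hMs : ∀ t v, (M t v).IsSymm) (hMpd : ∀ t v, (blkIn (inIx (D t)) (M t v)).PosDef) (t : ι)
    (v' : GaugeField P (k+1) U1) (ψ : HiggsField P (k+1))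
    (hvq : ∀ q : Cfg P k, vCut Qu (Λ t) ((D t).freeze q).1 v' = vCut Qu (Λ t) q.1 v')
    (hWgX : ∀ (e : (D t).Ext) (i : (D t).Int), Wg t ((D t).glue e i) v' ψ = Wg t ((D t).glue e (gaugePart (D t) (i.1, i.2.1))) v' ψ)
    (hWgi : ∀ e : (D t).Ext, Integrable (fun ab => Wg t ((D t).glue e (gaugePart (D t) ab)) v' ψ) (((D t).μIU m).prod (D t).μIP))
    (e : (D t).Ext) : Integrable (fun i => pW Λ Qu D M Wg t ((D t).glue e i) v' ψ) ((D t).μInt m) := by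
  have hF := integrable_wIn_cpl (inIx (D t)) (A := Mq Λ Qu M t ((D t).glue e (D t).base) v') (hMs t _) (hMpd t _) (chartOut (D t) e.2.2)
  have hF' := ((measurePreserving_chartIn (D t)).integrable_comp_emb (chartIn (D t)).measurableEmbedding).mpr hF
  refine ((measurePreserving_prodAssoc ((D t).μIU m) (D t).μIP (volume : Measure (D t).IX)).integrable_comp_emb
    (MeasurableEquiv.prodAssoc).measurableEmbedding).mp ?_
  rw [pW_glue_prodAssoc t v' ψ hvq hWgX e]
  exact (hWgi e).mul_prod hF'

/-- **`𝒩` OF THE FULL WEIGHT = `𝒩`(gauge) · `𝒩`(scalar)**: `normW (Wg·sW) = normG · calN` — Fubini over the product structure of the interior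
measure (`integral_prod_mul`), the scalar factor being p10's `𝒩` (`BIJ88Eq5128ScalarSector.normW_sW`'s computation).
[cite: BalabanImbrieJaffe1988, (5.12.7) p.302] -/
theorem normW_pW (t : ι) (v' : GaugeField P (k+1) U1) (ψ : HiggsField P (k+1))
    (hvq : ∀ q : Cfg P k, vCut Qu (Λ t) ((D t).freeze q).1 v' = vCut Qu (Λ t) q.1 v')
    (hWgX : ∀ (e : (D t).Ext) (i : (D t).Int), Wg t ((D t).glue e i) v' ψ = Wg t ((D t).glue e (gaugePart (D t) (i.1, i.2.1))) v' ψ)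
    (q : Cfg P k) :
    normW (D t) m (fun q' => pW Λ Qu D M Wg t q' v' ψ) q =
      normG D Wg m t ((D t).split q).1 v' ψ * calN (inIx (D t)) (Mq Λ Qu M t q v') (yOf (D t) q) := by
  rw [normW, condNorm]
  set gfun : (D t).IU × (D t).IP → ℝ := fun ab => Wg t ((D t).glue ((D t).split q).1 (gaugePart (D t) ab)) v' ψ with hg
  set ffun : (D t).IX → ℝ := fun c => wIn (inIx (D t)) (Mq Λ Qu M t q v') (chartIn (D t) c) *
    cpl (inIx (D t)) (Mq Λ Qu M t q v') (chartIn (D t) c) (yOf (D t) q) with hf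
  have hfun : (fun x : ((D t).IU × (D t).IP) × (D t).IX =>
      pW Λ Qu D M Wg t ((D t).glue ((D t).split q).1 (MeasurableEquiv.prodAssoc x)) v' ψ) = fun z => gfun z.1 * ffun z.2 := by
    have h0 := pW_glue_prodAssoc (M := M) t v' ψ hvq hWgX ((D t).split q).1
    rw [← Interior.freeze_eq_glue, Mq_congr (hvq q), ← BIJ88Eq5128ScalarSector.yOf_eq] at h0
    exact h0
  have e1 := (measurePreserving_prodAssoc ((D t).μIU m) (D t).μIP (volume : Measure (D t).IX)).integral_comp'
    (f := (MeasurableEquiv.prodAssoc : ((D t).IU × (D t).IP) × (D t).IX ≃ᵐ (D t).Int))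
    (fun i => pW Λ Qu D M Wg t ((D t).glue ((D t).split q).1 i) v' ψ)
  rw [Interior.μInt, ← e1, hfun, integral_prod_mul gfun ffun, hf, integral_chartIn (D t) (fun x =>
    wIn (inIx (D t)) (Mq Λ Qu M t q v') x * cpl (inIx (D t)) (Mq Λ Qu M t q v') x (yOf (D t) q))]
  rfl

/-- **ROW C2.Eq5.12.8 WITH THE WEIGHT OF (5.12.7) — (5.9.6) ⇒ (5.12.8), the gauge factor of the conditioning kept abstract, the scalar factor BY
NAME.**  Bracket read on configurations = `X₀ · Wg · exp(−½⟨φ^{(k)}, M_t(v)φ^{(k)}⟩) · B₀` (`X₀` interior-independent; `Wg` a positive jointly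
measurable weight of the interior gauge and previous-field variables — not of the interior scalar variables — integrable over each gauge fibre;
`M_t(v)` symmetric with positive definite `Λ₁₀`-block and measurable entries) ⇒ `IsDC` with exterior bracket
`X₀ · exp(−½⟨Λ₁₀ᶜφ,MΛ₁₀ᶜφ⟩) · 𝒩_gauge · Z_{Λ₁₀}(M_t(v)) · e^{thirdForm}`, interior law `dμ^{(k)}_{Λ₁₀} = 𝒩⁻¹ (Wg·wIn·cpl)·(interior law)` (`condW`) and
interior bracket `B₀`. [cite: BalabanImbrieJaffe1988, (5.12.8) p.303] -/
theorem eq5128_product {terms : Finset ι} {J : ι → Prev P k → GaugeField P k U1 → GaugeField P (k+1) U1 → HiggsField P k → HiggsField P (k+1) → ℂ}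
    {ρL : GaugeField P (k+1) U1 → HiggsField P (k+1) → ℂ}
    (h : IsDT (Measure.pi m) terms Λ Qu J ρL) (hQu : Measurable Qu)
    (hMs : ∀ t v, (M t v).IsSymm) (hMpd : ∀ t v, (blkIn (inIx (D t)) (M t v)).PosDef) (hMm : ∀ t i j, Measurable fun v => M t v i j)
    (hWgm : ∀ t, Measurable fun p : Cfg P k × (GaugeField P (k+1) U1 × HiggsField P (k+1)) => Wg t p.1 p.2.1 p.2.2)
    (hWg0 : ∀ t q v' ψ, 0 < Wg t q v' ψ)
    (hWgX : ∀ t (e : (D t).Ext) (i : (D t).Int) v' ψ, Wg t ((D t).glue e i) v' ψ = Wg t ((D t).glue e (gaugePart (D t) (i.1, i.2.1))) v' ψ)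
    (hWgi : ∀ t (e : (D t).Ext) v' ψ, Integrable (fun ab => Wg t ((D t).glue e (gaugePart (D t) ab)) v' ψ) (((D t).μIU m).prod (D t).μIP))
    (X₀ B₀ : ι → Cfg P k → GaugeField P (k+1) U1 → HiggsField P (k+1) → ℂ)
    (hv : ∀ t ∈ terms, ∀ (q : Cfg P k) (v' : GaugeField P (k+1) U1), vCut Qu (Λ t) ((D t).freeze q).1 v' = vCut Qu (Λ t) q.1 v')
    (hX₀ : ∀ t ∈ terms, ∀ q v' ψ, X₀ t ((D t).freeze q) v' ψ = X₀ t q v' ψ)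
    (hJ : ∀ t ∈ terms, ∀ q v' ψ, readEntry Λ Qu J t q v' ψ =
      X₀ t q v' ψ * (Wg t q v' ψ : ℂ) *
        (Real.exp (-(1 / 2 : ℝ) * (realCoords q.2.2 ⬝ᵥ (M t (vCut Qu (Λ t) q.1 v') *ᵥ realCoords q.2.2))) : ℂ) * B₀ t q v' ψ)
    (hJi : ∀ t ∈ terms, Integrable (termIntegrand Λ Qu J t) (termMeasure (Measure.pi m))) :
    IsDC terms Λ Qu (fun t => (D t).extMeasure m)
      (fun t q v' ψ => X₀ t q v' ψ * (sX Λ Qu D M t q v' : ℂ) *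
        ((normG D Wg m t ((D t).split q).1 v' ψ * (Zscalar (inIx (D t)) (Mq Λ Qu M t q v') *
          Real.exp (thirdForm (inIx (D t)) (Mq Λ Qu M t q v') (Mq Λ Qu M t q v') (yOf (D t) q))) : ℝ) : ℂ))
      (fun t q v' ψ => condW (D t) m (fun q' => pW Λ Qu D M Wg t q' v' ψ) q) B₀ ρL := by
  have h1 := isDC_of_isDT h hQu D (fun t q v' ψ => X₀ t q v' ψ * (sX Λ Qu D M t q v' : ℂ)) B₀ (pW Λ Qu D M Wg) hv
    (hfac_product hMs hv hX₀ hJ) (fun t _ => measurable_pW hQu hMm hWgm t) (fun t _ q v' ψ => pW_pos hWg0 t q v' ψ)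
    (fun t ht e v' ψ => integrable_pW_fibre hMs hMpd t v' ψ (fun q => hv t ht q v') (fun e i => hWgX t e i v' ψ) (fun e => hWgi t e v' ψ) e)
    hJi
  refine h1.congr (fun t ht q v' ψ => ?_) (fun _ _ _ _ _ => rfl)
  rw [normW_pW t v' ψ (fun q => hv t ht q v') (fun e i => hWgX t e i v' ψ) q,
    calN_eq_Zscalar_mul_exp_thirdForm _ (Mq Λ Qu M t q v') (hMs t _) (hMpd t _)]

/-! ## §4 THE PRODUCT STRUCTURE OF `dμ^{(k)}_{Λ^{(k)}_{10}}` (5.12.7): gauge conditional ⊗ p02's translated Gaussian `muφ` -/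

/-- **(5.12.7) AT MEASURE LEVEL — `dμ^{(k)}_{Λ₁₀}(A″, φ″) = dμ_{gauge}(A″) ⊗ dμ_{scalar}(φ″)`, THE SCALAR FACTOR BEING p02's `muφ` BY NAME.**  Over
the fibre of the exterior configuration `e`, the conditioned interior measure of the full weight is the image under the regrouping
`((A″, u^{(j)}″), φ″) ↦ (A″, (u^{(j)}″, φ″))` of the PRODUCT of (i) the gauge conditional `𝒩_g⁻¹ Wg · (du|_{Λ^{c*c}_{10}} Π du^{(j)}|_{Λ^{(j)*}_{10}})` and
(ii) `BIJ88Measure5127.muφ (M_Λ) (J)` — *"an uncentered, normalized Gaussian measure"* with covariance `C_{Λ₁₀}(u_{k+1}) = M_Λ⁻¹` and mean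
`−M_Λ⁻¹J`, `J = ΛMΛᶜφ` (`srcJ`) — read in the real coordinates of `φ″|_{Λ₁₀}` (`chartIn⁻¹`). [cite: BalabanImbrieJaffe1988, (5.12.7) p.302] -/
theorem condMeasure_pW_eq_prod (hMs : ∀ t v, (M t v).IsSymm)
    (hMpd : ∀ t v, (blkIn (inIx (D t)) (M t v)).PosDef)
    (hWgm : ∀ t, Measurable fun p : Cfg P k × (GaugeField P (k+1) U1 × HiggsField P (k+1)) => Wg t p.1 p.2.1 p.2.2)
    (hWg0 : ∀ t q v' ψ, 0 < Wg t q v' ψ) (t : ι) (v' : GaugeField P (k+1) U1) (ψ : HiggsField P (k+1))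
    (hvq : ∀ q : Cfg P k, vCut Qu (Λ t) ((D t).freeze q).1 v' = vCut Qu (Λ t) q.1 v')
    (hWgX : ∀ (e : (D t).Ext) (i : (D t).Int), Wg t ((D t).glue e i) v' ψ = Wg t ((D t).glue e (gaugePart (D t) (i.1, i.2.1))) v' ψ)
    (hWgi : ∀ e : (D t).Ext, Integrable (fun ab => Wg t ((D t).glue e (gaugePart (D t) ab)) v' ψ) (((D t).μIU m).prod (D t).μIP))
    (e : (D t).Ext) :
    condMeasure ((D t).μInt m) (fun i => pW Λ Qu D M Wg t ((D t).glue e i) v' ψ) =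
      ((condMeasure (((D t).μIU m).prod (D t).μIP) (fun ab => Wg t ((D t).glue e (gaugePart (D t) ab)) v' ψ)).prod
        ((muφ (blkIn (inIx (D t)) (Mq Λ Qu M t ((D t).glue e (D t).base) v'))
          (srcJ (inIx (D t)) (Mq Λ Qu M t ((D t).glue e (D t).base) v') (chartOut (D t) e.2.2))).map (chartIn (D t)).symm)).map
        (MeasurableEquiv.prodAssoc : ((D t).IU × (D t).IP) × (D t).IX ≃ᵐ (D t).Int) := by
  set A := Mq Λ Qu M t ((D t).glue e (D t).base) v' with hAdef
  set y := chartOut (D t) e.2.2 with hydef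
  have hμ : (D t).μInt m = Measure.map (MeasurableEquiv.prodAssoc : ((D t).IU × (D t).IP) × (D t).IX ≃ᵐ (D t).Int)
      ((((D t).μIU m).prod (D t).μIP).prod (volume : Measure (D t).IX)) :=
    (measurePreserving_prodAssoc ((D t).μIU m) (D t).μIP (volume : Measure (D t).IX)).map_eq.symm
  rw [hμ, condMeasure_map_equiv, pW_glue_prodAssoc t v' ψ hvq hWgX e]
  have hgm : Measurable fun ab : (D t).IU × (D t).IP => Wg t ((D t).glue e (gaugePart (D t) ab)) v' ψ :=
    (hWgm t).comp ((((D t).measurableEmbedding_glue e).measurable.comp (measurable_gaugePart (D t))).prodMk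
      (measurable_const : Measurable fun _ : (D t).IU × (D t).IP => (v', ψ)))
  have hfm : Measurable fun c : (D t).IX => wIn (inIx (D t)) A (chartIn (D t) c) * cpl (inIx (D t)) A (chartIn (D t) c) y :=
    BIJ88Eq5128ScalarSector.measurable_wIn_cpl (inIx (D t)) (A := fun _ => A) (fun _ _ => measurable_const) (chartIn (D t)).measurable
      measurable_const
  have hF := integrable_wIn_cpl (inIx (D t)) (A := A) (hMs t _) (hMpd t _) y
  have hF' := ((measurePreserving_chartIn (D t)).integrable_comp_emb (chartIn (D t)).measurableEmbedding).mpr hF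
  rw [condMeasure_prod _ _ hgm hfm (fun _ => (hWg0 t _ v' ψ).le)
    (fun c => by unfold wIn cpl; exact (mul_pos (Real.exp_pos _) (Real.exp_pos _)).le) (hWgi e) hF']
  congr 2
  rw [show (fun c : (D t).IX => wIn (inIx (D t)) A (chartIn (D t) c) * cpl (inIx (D t)) A (chartIn (D t) c) y) =
      (fun x => wIn (inIx (D t)) A x * cpl (inIx (D t)) A x y) ∘ (chartIn (D t)) from rfl,
    condMeasure_comp_equiv (chartIn (D t)) (measurePreserving_chartIn (D t))]
  congr 1
  have hw : (fun x => wIn (inIx (D t)) A x * cpl (inIx (D t)) A x y) =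
      fun x => Real.exp (-(srcJ (inIx (D t)) A y ⬝ᵥ x) - 1 / 2 * (x ⬝ᵥ (blkIn (inIx (D t)) A *ᵥ x))) :=
    funext fun x => wIn_mul_cpl (inIx (D t)) A (hMs t _) x y
  have hApd : (blkIn (inIx (D t)) A).PosDef := hMpd t _
  rw [hw, condMeasure_tilt hApd]

/-- **`dμ^{(k)}_{Λ^{(k)}_{10}}` of the frame, with the weight of (5.12.7), IS the product measure** glued at the exterior configuration: `condW` at the
glued configuration `glue e i` is the fibre law of (gauge conditional) ⊗ (`muφ` in real coordinates). [cite: BalabanImbrieJaffe1988, (5.12.7) p.302] -/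
theorem condW_pW_eq (hMs : ∀ t v, (M t v).IsSymm)
    (hMpd : ∀ t v, (blkIn (inIx (D t)) (M t v)).PosDef)
    (hWgm : ∀ t, Measurable fun p : Cfg P k × (GaugeField P (k+1) U1 × HiggsField P (k+1)) => Wg t p.1 p.2.1 p.2.2)
    (hWg0 : ∀ t q v' ψ, 0 < Wg t q v' ψ) (t : ι) (v' : GaugeField P (k+1) U1) (ψ : HiggsField P (k+1))
    (hvq : ∀ q : Cfg P k, vCut Qu (Λ t) ((D t).freeze q).1 v' = vCut Qu (Λ t) q.1 v')
    (hWgX : ∀ (e : (D t).Ext) (i : (D t).Int), Wg t ((D t).glue e i) v' ψ = Wg t ((D t).glue e (gaugePart (D t) (i.1, i.2.1))) v' ψ)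
    (hWgi : ∀ e : (D t).Ext, Integrable (fun ab => Wg t ((D t).glue e (gaugePart (D t) ab)) v' ψ) (((D t).μIU m).prod (D t).μIP))
    (e : (D t).Ext) (i : (D t).Int) :
    condW (D t) m (fun q' => pW Λ Qu D M Wg t q' v' ψ) ((D t).glue e i) =
      (D t).fibreMeasure (((condMeasure (((D t).μIU m).prod (D t).μIP) (fun ab => Wg t ((D t).glue e (gaugePart (D t) ab)) v' ψ)).prod
        ((muφ (blkIn (inIx (D t)) (Mq Λ Qu M t ((D t).glue e (D t).base) v'))
          (srcJ (inIx (D t)) (Mq Λ Qu M t ((D t).glue e (D t).base) v') (chartOut (D t) e.2.2))).map (chartIn (D t)).symm)).map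
        (MeasurableEquiv.prodAssoc : ((D t).IU × (D t).IP) × (D t).IX ≃ᵐ (D t).Int)) e := by
  rw [condW, Interior.split_glue, condMeasure_pW_eq_prod hMs hMpd hWgm hWg0 t v' ψ hvq hWgX hWgi e]

/-- **THE SCALAR MARGINAL OF `dμ^{(k)}_{Λ^{(k)}_{10}}` IS p02's `muφ`** — pushing the conditioned interior law (weight of (5.12.7)) forward to the real
coordinates of the interior scalar field `φ″|_{Λ₁₀}` gives exactly `BIJ88Measure5127.muφ (M_Λ) (ΛMΛᶜφ)` (the gauge conditional has mass one).
[cite: BalabanImbrieJaffe1988, (5.12.7) p.302] -/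
theorem map_scalar_condMeasure_pW (hMs : ∀ t v, (M t v).IsSymm) (hMpd : ∀ t v, (blkIn (inIx (D t)) (M t v)).PosDef)
    (hWgm : ∀ t, Measurable fun p : Cfg P k × (GaugeField P (k+1) U1 × HiggsField P (k+1)) => Wg t p.1 p.2.1 p.2.2)
    (hWg0 : ∀ t q v' ψ, 0 < Wg t q v' ψ) (t : ι) (v' : GaugeField P (k+1) U1) (ψ : HiggsField P (k+1))
    (hvq : ∀ q : Cfg P k, vCut Qu (Λ t) ((D t).freeze q).1 v' = vCut Qu (Λ t) q.1 v')
    (hWgX : ∀ (e : (D t).Ext) (i : (D t).Int), Wg t ((D t).glue e i) v' ψ = Wg t ((D t).glue e (gaugePart (D t) (i.1, i.2.1))) v' ψ)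
    (hWgi : ∀ e : (D t).Ext, Integrable (fun ab => Wg t ((D t).glue e (gaugePart (D t) ab)) v' ψ) (((D t).μIU m).prod (D t).μIP))
    (e : (D t).Ext) :
    (condMeasure ((D t).μInt m) (fun i => pW Λ Qu D M Wg t ((D t).glue e i) v' ψ)).map (fun i : (D t).Int => chartIn (D t) i.2.2) =
      muφ (blkIn (inIx (D t)) (Mq Λ Qu M t ((D t).glue e (D t).base) v'))
        (srcJ (inIx (D t)) (Mq Λ Qu M t ((D t).glue e (D t).base) v') (chartOut (D t) e.2.2)) := by
  have hgi := hWgi e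
  haveI : IsProbabilityMeasure (condMeasure (((D t).μIU m).prod (D t).μIP) (fun ab => Wg t ((D t).glue e (gaugePart (D t) ab)) v' ψ)) :=
    BIJ88Eq5128CondExpect.isProbabilityMeasure_condMeasure (fun _ => (hWg0 t _ v' ψ).le) hgi
      (condNorm_pos (fun _ => hWg0 t _ v' ψ) hgi)
  have hApd : (blkIn (inIx (D t)) (Mq Λ Qu M t ((D t).glue e (D t).base) v')).PosDef := hMpd t _
  haveI : IsProbabilityMeasure (muφ (blkIn (inIx (D t)) (Mq Λ Qu M t ((D t).glue e (D t).base) v'))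
      (srcJ (inIx (D t)) (Mq Λ Qu M t ((D t).glue e (D t).base) v') (chartOut (D t) e.2.2))) :=
    BIJ88Measure5127.isProbabilityMeasure_muφ _ _ hApd
  haveI : IsProbabilityMeasure ((muφ (blkIn (inIx (D t)) (Mq Λ Qu M t ((D t).glue e (D t).base) v'))
      (srcJ (inIx (D t)) (Mq Λ Qu M t ((D t).glue e (D t).base) v') (chartOut (D t) e.2.2))).map ⇑(chartIn (D t)).symm) :=
    Measure.isProbabilityMeasure_map (chartIn (D t)).symm.measurable.aemeasurable
  rw [condMeasure_pW_eq_prod hMs hMpd hWgm hWg0 t v' ψ hvq hWgX hWgi e,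
    Measure.map_map (g := fun i : (D t).Int => chartIn (D t) i.2.2) ((chartIn (D t)).measurable.comp measurable_snd.snd)
      (MeasurableEquiv.prodAssoc).measurable]
  have hc : (fun i : (D t).Int => chartIn (D t) i.2.2) ∘ ⇑(MeasurableEquiv.prodAssoc : ((D t).IU × (D t).IP) × (D t).IX ≃ᵐ (D t).Int) =
      ⇑(chartIn (D t)) ∘ Prod.snd := by
    funext z; rfl
  rw [hc, ← Measure.map_map (chartIn (D t)).measurable measurable_snd, Measure.map_snd_prod, measure_univ, one_smul,
    Measure.map_map (chartIn (D t)).measurable (chartIn (D t)).symm.measurable, MeasurableEquiv.self_comp_symm, Measure.map_id]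

/-- **… AND IS MATHLIB'S MULTIVARIATE GAUSSIAN** with mean `meanφ = −M_Λ⁻¹(ΛMΛᶜφ)` and covariance matrix `M_Λ⁻¹ = C_{Λ₁₀}(u_{k+1})` (p02's
`BIJ88Measure5127.map_toLp_muφ`): *"This measure has covariances … C^{(k)}_{Λ^{(k)}_{10}}(u_{k+1}), and nonzero means reflecting the terms linear in
Λ^{(k)}_{10}φ^{(k)″}"* — for the scalar half, literally. [cite: BalabanImbrieJaffe1988, (5.12.7) p.302] -/
theorem map_scalar_condMeasure_pW_eq_multivariateGaussian (hMs : ∀ t v, (M t v).IsSymm)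
    (hMpd : ∀ t v, (blkIn (inIx (D t)) (M t v)).PosDef)
    (hWgm : ∀ t, Measurable fun p : Cfg P k × (GaugeField P (k+1) U1 × HiggsField P (k+1)) => Wg t p.1 p.2.1 p.2.2)
    (hWg0 : ∀ t q v' ψ, 0 < Wg t q v' ψ) (t : ι) (v' : GaugeField P (k+1) U1) (ψ : HiggsField P (k+1))
    (hvq : ∀ q : Cfg P k, vCut Qu (Λ t) ((D t).freeze q).1 v' = vCut Qu (Λ t) q.1 v')
    (hWgX : ∀ (e : (D t).Ext) (i : (D t).Int), Wg t ((D t).glue e i) v' ψ = Wg t ((D t).glue e (gaugePart (D t) (i.1, i.2.1))) v' ψ)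
    (hWgi : ∀ e : (D t).Ext, Integrable (fun ab => Wg t ((D t).glue e (gaugePart (D t) ab)) v' ψ) (((D t).μIU m).prod (D t).μIP))
    (e : (D t).Ext) :
    (condMeasure ((D t).μInt m) (fun i => pW Λ Qu D M Wg t ((D t).glue e i) v' ψ)).map
        (fun i : (D t).Int => (MeasurableEquiv.toLp 2 (In (inIx (D t)) → ℝ)) (chartIn (D t) i.2.2)) =
      ProbabilityTheory.multivariateGaussian
        (WithLp.toLp 2 (BIJ88Measure5127.meanφ (blkIn (inIx (D t)) (Mq Λ Qu M t ((D t).glue e (D t).base) v'))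
          (srcJ (inIx (D t)) (Mq Λ Qu M t ((D t).glue e (D t).base) v') (chartOut (D t) e.2.2))))
        (blkIn (inIx (D t)) (Mq Λ Qu M t ((D t).glue e (D t).base) v'))⁻¹ := by
  rw [show (fun i : (D t).Int => (MeasurableEquiv.toLp 2 (In (inIx (D t)) → ℝ)) (chartIn (D t) i.2.2)) =
      ⇑(MeasurableEquiv.toLp 2 (In (inIx (D t)) → ℝ)) ∘ (fun i : (D t).Int => chartIn (D t) i.2.2) from rfl,
    ← Measure.map_map (g := ⇑(MeasurableEquiv.toLp 2 (In (inIx (D t)) → ℝ))) (f := fun i : (D t).Int => chartIn (D t) i.2.2)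
      (MeasurableEquiv.toLp 2 (In (inIx (D t)) → ℝ)).measurable ((chartIn (D t)).measurable.comp measurable_snd.snd),
    map_scalar_condMeasure_pW hMs hMpd hWgm hWg0 t v' ψ hvq hWgX hWgi e]
  have hApd : (blkIn (inIx (D t)) (Mq Λ Qu M t ((D t).glue e (D t).base) v')).PosDef := hMpd t _
  exact BIJ88Measure5127.map_toLp_muφ _ _ hApd

/-! ## §5 Instances: `𝒟u δ_{Ax}` and the block average of record -/

/-- **Instance `ν = ∫𝒟u δ_{Ax}(u)(·)`** of `eq5128_product` (`𝒟u δ_{Ax} = Π_b axialLaw_b`). [cite: BalabanImbrieJaffe1988, (5.12.8) p.303] -/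
theorem eq5128_product_axial {terms : Finset ι}
    {J : ι → Prev P k → GaugeField P k U1 → GaugeField P (k+1) U1 → HiggsField P k → HiggsField P (k+1) → ℂ}
    {ρL : GaugeField P (k+1) U1 → HiggsField P (k+1) → ℂ}
    (h : IsDT (BIJ88RenormTransf311.axialMeasure P k U1) terms Λ Qu J ρL) (hQu : Measurable Qu)
    (hMs : ∀ t v, (M t v).IsSymm) (hMpd : ∀ t v, (blkIn (inIx (D t)) (M t v)).PosDef) (hMm : ∀ t i j, Measurable fun v => M t v i j)
    (hWgm : ∀ t, Measurable fun p : Cfg P k × (GaugeField P (k+1) U1 × HiggsField P (k+1)) => Wg t p.1 p.2.1 p.2.2)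
    (hWg0 : ∀ t q v' ψ, 0 < Wg t q v' ψ)
    (hWgX : ∀ t (e : (D t).Ext) (i : (D t).Int) v' ψ, Wg t ((D t).glue e i) v' ψ = Wg t ((D t).glue e (gaugePart (D t) (i.1, i.2.1))) v' ψ)
    (hWgi : ∀ t (e : (D t).Ext) v' ψ,
      Integrable (fun ab => Wg t ((D t).glue e (gaugePart (D t) ab)) v' ψ) (((D t).μIU (axialLaw P k)).prod (D t).μIP))
    (X₀ B₀ : ι → Cfg P k → GaugeField P (k+1) U1 → HiggsField P (k+1) → ℂ)
    (hv : ∀ t ∈ terms, ∀ (q : Cfg P k) (v' : GaugeField P (k+1) U1), vCut Qu (Λ t) ((D t).freeze q).1 v' = vCut Qu (Λ t) q.1 v')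
    (hX₀ : ∀ t ∈ terms, ∀ q v' ψ, X₀ t ((D t).freeze q) v' ψ = X₀ t q v' ψ)
    (hJ : ∀ t ∈ terms, ∀ q v' ψ, readEntry Λ Qu J t q v' ψ =
      X₀ t q v' ψ * (Wg t q v' ψ : ℂ) *
        (Real.exp (-(1 / 2 : ℝ) * (realCoords q.2.2 ⬝ᵥ (M t (vCut Qu (Λ t) q.1 v') *ᵥ realCoords q.2.2))) : ℂ) * B₀ t q v' ψ)
    (hJi : ∀ t ∈ terms, Integrable (termIntegrand Λ Qu J t) (termMeasure (Measure.pi (axialLaw P k)))) :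
    IsDC terms Λ Qu (fun t => (D t).extMeasure (axialLaw P k))
      (fun t q v' ψ => X₀ t q v' ψ * (sX Λ Qu D M t q v' : ℂ) *
        ((normG D Wg (axialLaw P k) t ((D t).split q).1 v' ψ * (Zscalar (inIx (D t)) (Mq Λ Qu M t q v') *
          Real.exp (thirdForm (inIx (D t)) (Mq Λ Qu M t q v') (Mq Λ Qu M t q v') (yOf (D t) q))) : ℝ) : ℂ))
      (fun t q v' ψ => condW (D t) (axialLaw P k) (fun q' => pW Λ Qu D M Wg t q' v' ψ) q) B₀ ρL :=
  eq5128_product (m := axialLaw P k) (isDT_axial_iff.mp h) hQu hMs hMpd hMm hWgm hWg0 hWgX hWgi X₀ B₀ hv hX₀ hJ hJi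

/-- **The locality `hv` BY NAME for r18's block average `qU`** under the nesting condition of p. 300 (`BIJ88Eq5128Locality.vCut_freeze_eq_qU`):
(5.12.8) with the weight of (5.12.7), hypotheses = printed data (`M`, `Wg`, `X₀`, `B₀`, index sets) + integrability.
[cite: BalabanImbrieJaffe1988, (5.12.8) p.303] -/
theorem eq5128_product_qU {terms : Finset ι} {Λ : ι → Finset (PBond P (k+1))} {D : ι → Interior P k}
    {M : ι → GaugeField P (k+1) U1 → Matrix (RIdx P k) (RIdx P k) ℝ} {Wg : ι → Cfg P k → GaugeField P (k+1) U1 → HiggsField P (k+1) → ℝ}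
    {J : ι → Prev P k → GaugeField P k U1 → GaugeField P (k+1) U1 → HiggsField P k → HiggsField P (k+1) → ℂ}
    {ρL : GaugeField P (k+1) U1 → HiggsField P (k+1) → ℂ}
    (h : IsDT (Measure.pi m) terms Λ BIJ85BlockAveragesTorus.qU J ρL)
    (hMs : ∀ t v, (M t v).IsSymm) (hMpd : ∀ t v, (blkIn (inIx (D t)) (M t v)).PosDef) (hMm : ∀ t i j, Measurable fun v => M t v i j)
    (hWgm : ∀ t, Measurable fun p : Cfg P k × (GaugeField P (k+1) U1 × HiggsField P (k+1)) => Wg t p.1 p.2.1 p.2.2)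
    (hWg0 : ∀ t q v' ψ, 0 < Wg t q v' ψ)
    (hWgX : ∀ t (e : (D t).Ext) (i : (D t).Int) v' ψ, Wg t ((D t).glue e i) v' ψ = Wg t ((D t).glue e (gaugePart (D t) (i.1, i.2.1))) v' ψ)
    (hWgi : ∀ t (e : (D t).Ext) v' ψ, Integrable (fun ab => Wg t ((D t).glue e (gaugePart (D t) ab)) v' ψ) (((D t).μIU m).prod (D t).μIP))
    (X₀ B₀ : ι → Cfg P k → GaugeField P (k+1) U1 → HiggsField P (k+1) → ℂ)
    (hIb : ∀ t ∈ terms, ∀ c, c ∉ Λ t → ∀ b ∈ BIJ88Eq5128Locality.qUSupport c, b ∉ (D t).Ib)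
    (hX₀ : ∀ t ∈ terms, ∀ q v' ψ, X₀ t ((D t).freeze q) v' ψ = X₀ t q v' ψ)
    (hJ : ∀ t ∈ terms, ∀ q v' ψ, readEntry Λ BIJ85BlockAveragesTorus.qU J t q v' ψ =
      X₀ t q v' ψ * (Wg t q v' ψ : ℂ) * (Real.exp (-(1 / 2 : ℝ) * (realCoords q.2.2 ⬝ᵥ
        (M t (vCut BIJ85BlockAveragesTorus.qU (Λ t) q.1 v') *ᵥ realCoords q.2.2))) : ℂ) * B₀ t q v' ψ)
    (hJi : ∀ t ∈ terms, Integrable (termIntegrand Λ BIJ85BlockAveragesTorus.qU J t) (termMeasure (Measure.pi m))) :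
    IsDC terms Λ BIJ85BlockAveragesTorus.qU (fun t => (D t).extMeasure m)
      (fun t q v' ψ => X₀ t q v' ψ * (sX Λ BIJ85BlockAveragesTorus.qU D M t q v' : ℂ) *
        ((normG D Wg m t ((D t).split q).1 v' ψ * (Zscalar (inIx (D t)) (Mq Λ BIJ85BlockAveragesTorus.qU M t q v') *
          Real.exp (thirdForm (inIx (D t)) (Mq Λ BIJ85BlockAveragesTorus.qU M t q v') (Mq Λ BIJ85BlockAveragesTorus.qU M t q v')
            (yOf (D t) q))) : ℝ) : ℂ))
      (fun t q v' ψ => condW (D t) m (fun q' => pW Λ BIJ85BlockAveragesTorus.qU D M Wg t q' v' ψ) q) B₀ ρL :=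
  eq5128_product h BIJ85BlockAveragesTorus.measurable_qU hMs hMpd hMm hWgm hWg0 hWgX hWgi X₀ B₀
    (fun t ht q v' => BIJ88Eq5128Locality.vCut_freeze_eq_qU (D t) (Λ t) (hIb t ht) q v') hX₀ hJ hJi

end Product

end

end Literature.MathematicalPhysics.QuantumFieldTheory.BalabanImbrieJaffe1984to88.BIJ88Eq5127ProductMeasure
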